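import Summits.ResolutionOfSingularities.ResolutionOfSingularities.Theorems.FrobeniusClosingSteerHeartDense
import Summits.ResolutionOfSingularities.ResolutionOfSingularities.Theorems.FrobeniusClosingSteerWords03Phases
import HarnessLib

/-!
# Crux `Steer` (stmt-ResolutionOfSingularities-16345), line `switching_dichotomy`: the (α) heart S3ᴹ is the DENSE case —
# `dense_of_forall_not_toroidal` (p523293) read in the skeleton's own vocabulary (`CoreDatum`, `LogExitAt`, `IsExcParam`,
# `IsFracOf`)

OURS (campaign `res-hironaka`, rung L ★L-G4, slot W4.1, chain W4.1; seat `res-L0-w41-strat-1` g5, crux strategist alongside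
the holder res-L0-w41-lead-1; Theses-free, definition-free helper `--supports stmt-ResolutionOfSingularities-16345`; replaces
the role of no printed item; NOT a statement of the manuscript under review [claim: Hironaka2017, status: under-review];
AI-produced, which is weaker than expert review).

`dense_of_coreDatum`: in the context of the registered residual `stub_eternalCyclesSSM` (skeleton of record r28, statement
unchanged through r34) — a core datum `CoreDatum p n k K O A₀ h₀ t`, the point sequence `R` of the base from
`locAtCentre A₀ O`, NO log-final member (`∀ M, ¬ LogExitAt (R M) p A₀ t`) and DIVERGENT exceptional values (the binder handed
down from E-8 `divergent_of_core_not_isTorsorRun`, p507885, specialised to `¬ HasProperCoarsening O`) — the radicand generator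
`t` is a `v`-limit of members: `∀ w ≠ 0, ∃ M, ∃ g ∈ R M, v (t - g) < v w`. One-line wrapper of `dense_of_forall_not_toroidal`
(only the E2 = toroidal half of `¬ LogExitAt` is used; `t ∉ Frac A₀` comes from `CoreDatum`'s «`t ^ p` is not a `p`-th power at
the centre» via `SteeredRun.not_mem_closure_of_ne_pow`, p499045). Corollary `not_distFinite_of_coreDatum`: `t` is a `v`-limit
of elements of `O ∩ Frac A₀` (`IsFracOf`), i.e. the «finite distance» half of the heart is EMPTY and `EternalCyclesSSM` may be
given the extra binder `∀ w ≠ 0, ∃ M g, g ∈ R M ∧ v (t - g) < v w` at no cost (strictly weaker residual, count-neutral).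
No rank-one / strongly-switching / `p ≠ 2` / `4 ≤ n` hypothesis is needed. [folklore]
-/

-- `Summit.<S>.<S>.…` duplicates the summit name by design (single-problem summit).
set_option linter.dupNamespace false

open IsLocalRing
open Literature.AlgebraicGeometry.Resolution
open Summit.ResolutionOfSingularities.ResolutionOfSingularities.Theorems.SteerRankThinness
open Summit.ResolutionOfSingularities.ResolutionOfSingularities.Theorems.SwitchingDichotomy.Words

namespace Summit.ResolutionOfSingularities.ResolutionOfSingularities.Theorems.SwitchingDichotomy

namespace EventualMonomial

variable {k K : Type} [Field k] [Field K] [Algebra k K]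

/-- **The heart is dense** (skeleton vocabulary). Under a core datum, along the point sequence of the base, with no log-final
member and divergent exceptional values, `t` is a `v`-limit of members `g ∈ R M`. [folklore] -/
theorem dense_of_coreDatum (p n : ℕ) (hp : p.Prime) [CharP k p] [PerfectField k]
    (O : ValuationSubring K) (A₀ : Subalgebra k K) (h₀ : A₀.toSubring ≤ O.toSubring) (t : K)
    (core : CoreDatum p n k K O A₀ h₀ t)
    (R : ℕ → Subring K) (hR0 : R 0 = locAtCentre A₀.toSubring O)
    (hRq : ∀ i, IsQuadraticTransformAlong O (R i) (R (i + 1)))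
    (hlog : ∀ M, ¬ LogExitAt (R M) p A₀ t)
    (hdiv : ∀ x : ℕ → K, (∀ i, IsExcParam O (R i) (x i)) →
      ∀ c : K, c ≠ 0 → ∃ m, (∏ i ∈ Finset.range m, O.valuation (x i)) < O.valuation c) :
    ∀ w : K, w ≠ 0 → ∃ (M : ℕ) (g : K), g ∈ R M ∧ O.valuation (t - g) < O.valuation w := by
  obtain ⟨-, htp, -, hreg, -, hzd, -, -, -, -, -, hc, -, -⟩ := core
  have htF : ¬ ∃ y ∈ A₀, ∃ z ∈ A₀, z ≠ 0 ∧ t = y / z := fun h =>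
    SteeredRun.not_mem_closure_of_ne_pow O A₀ h₀ hp.ne_zero t htp hreg hc
      ((exists_div_iff_mem_closure A₀ t).mp h)
  exact dense_of_forall_not_toroidal p hp O A₀ h₀ t htp hreg hzd htF R hR0 hRq
    (fun N hN t₂ ht₂ htor => hlog N ⟨hN, Or.inr ⟨t₂, ht₂, htor⟩⟩) (fun x hx => hdiv x hx)

/-- **Corollary: the «finite distance» half of the heart is empty.** Under the same hypotheses `t` is a `v`-limit of
elements of `O ∩ Frac A₀`. [folklore] -/
theorem not_distFinite_of_coreDatum (p n : ℕ) (hp : p.Prime) [CharP k p] [PerfectField k]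
    (O : ValuationSubring K) (A₀ : Subalgebra k K) (h₀ : A₀.toSubring ≤ O.toSubring) (t : K)
    (core : CoreDatum p n k K O A₀ h₀ t)
    (R : ℕ → Subring K) (hR0 : R 0 = locAtCentre A₀.toSubring O)
    (hRq : ∀ i, IsQuadraticTransformAlong O (R i) (R (i + 1)))
    (hlog : ∀ M, ¬ LogExitAt (R M) p A₀ t)
    (hdiv : ∀ x : ℕ → K, (∀ i, IsExcParam O (R i) (x i)) →
      ∀ c : K, c ≠ 0 → ∃ m, (∏ i ∈ Finset.range m, O.valuation (x i)) < O.valuation c) :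
    ∀ w : K, w ≠ 0 → ∃ g : K, g ∈ O ∧ IsFracOf A₀ g ∧ O.valuation (t - g) < O.valuation w := by
  intro w hw
  obtain ⟨M, g, hg, hlt⟩ := dense_of_coreDatum p n hp O A₀ h₀ t core R hR0 hRq hlog hdiv w hw
  obtain ⟨-, -, -, hreg, -⟩ := core
  obtain ⟨-, hRdom, -, hRfrac⟩ := sequence_facts O A₀ h₀ hreg R hR0 hRq
  exact ⟨g, (hRdom M).1 hg, hRfrac M g hg, hlt⟩

end EventualMonomial

end Summit.ResolutionOfSingularities.ResolutionOfSingularities.Theorems.SwitchingDichotomy
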